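import Mathlib

/-!
# The `p`-adic size of `(1+p)^t - 1`

Stub `stub_normCycPow` of the line `lambda-layer-one` of the crux `EdgeDecay`
(`Summit.BirchSwinnertonDyer.BirchSwinnertonDyer.Theses.TangentCone.EdgeDecay`).

For an odd prime `p` and `t > 0`, lifting the exponent gives
`v_p((1+p)^t - 1) = v_p((1+p) - 1) + v_p(t) = 1 + v_p(t)`, hence
`‖(1+p)^t - 1‖_p = p^(-v_p(t) - 1)`. This computes the size of the evaluation points
`γ^t - 1` (`γ = 1 + p` the cyclotomic generator) of the two-variable power series in the line.
-/

set_option linter.dupNamespace false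

namespace Summit.BirchSwinnertonDyer.BirchSwinnertonDyer.Theorems

/-- The norm of a nonzero natural number `n` in `ℚ_[p]` is `p ^ (-v_p(n))`. [folklore] -/
private theorem normCycPow_norm_natCast {p : ℕ} [Fact p.Prime] {n : ℕ} (hn : n ≠ 0) :
    ‖(n : ℚ_[p])‖ = (p : ℝ) ^ (-(padicValNat p n : ℤ)) := by
  rw [Padic.norm_eq_zpow_neg_valuation (by exact_mod_cast hn), Padic.valuation_natCast]

/-- Lifting the exponent in `ℕ`: `v_p((1+p)^t - 1) = v_p(t) + 1` for `p` odd, `t ≠ 0`.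
[folklore] -/
private theorem normCycPow_padicValNat_pow_sub_one {p : ℕ} [hp : Fact p.Prime] (hp2 : p ≠ 2)
    {t : ℕ} (ht : t ≠ 0) :
    padicValNat p ((1 + p) ^ t - 1) = padicValNat p t + 1 := by
  have hodd : Odd p := hp.out.odd_of_ne_two hp2
  have h := padicValNat.pow_sub_pow (p := p) (x := 1 + p) (y := 1) hodd
    (by have := hp.out.pos; omega) (by simp) (by simp [hp.out.ne_one]) ht
  rw [one_pow] at h
  rw [h, show 1 + p - 1 = p by omega, padicValNat_self]
  ring

/-- For an odd prime `p` and `t > 0`, `‖(1+p)^t - 1‖_p = p ^ (-v_p(t) - 1)`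
(lifting the exponent). [folklore] -/
theorem stub_normCycPow :
    ∀ (p : ℕ) [Fact p.Prime], p ≠ 2 → ∀ t : ℕ, 0 < t → ‖((1 + p : ℕ) : ℚ_[p]) ^ t - 1‖ = (p : ℝ) ^ (-(padicValNat p t : ℤ) - 1) := by
  intro p _ hp2 t ht
  have hle : 1 ≤ (1 + p) ^ t := Nat.one_le_pow _ _ (by omega)
  have hN : (1 + p) ^ t - 1 ≠ 0 := by
    have : 1 < (1 + p) ^ t := Nat.one_lt_pow ht.ne' (by have := (Fact.out : p.Prime).pos; omega)
    omega
  have hcast : ((1 + p : ℕ) : ℚ_[p]) ^ t - 1 = (((1 + p) ^ t - 1 : ℕ) : ℚ_[p]) := by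
    push_cast [Nat.cast_sub hle]
    ring
  rw [hcast, normCycPow_norm_natCast hN, normCycPow_padicValNat_pow_sub_one hp2 ht.ne']
  congr 1
  push_cast
  ring

end Summit.BirchSwinnertonDyer.BirchSwinnertonDyer.Theorems
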